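import Summits.ABC.IUTFork.Repair.RHShallowWuc
import Summits.ABC.IUTFork.Repair.CandInternal2Real
import HarnessLib

/-!
# D-0079 RESCUE sub-cell R-H, ROUND 1 row 6 «shallow-wuc» — TESTER k2 record: H⋆_6 = `RHShallowWuc.HStarShallowWuc` does NOT survive the
# UNRAMIFIED-ODD refutation family — it is FALSE at every genuine datum having an unramified bad place, and the landed Negative lemma
# `CandInternal2Real.not_mem_jsq_smul_logShell_of_unramified` bites it BY NAME through abc-iut-rh-typ-6's `RHShallowWuc.realStar_of_hStar`

PROOF-ONLY record file (D-0012; 0 definitions, 0 `Prop` facts) of the abc-iut cell, rung LADDER-ABC:A2.RESCUE.H; seat abc-iut-rh-tst-6 gen 0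
(R-H ROUND 1 PAIR n = 6 TESTER; director-abc W13 (A) 15:32:46Z, D-0107: «k2 — does H⋆_n survive the unramified-odd refutation family that killed
I06⋆ as typed»). Row 6 of `plan/rescue/R-H/RH-CANDIDATES.tsv` (one writer abc-iut-rh-lead g0); deciding declaration abc-iut-rh-typ-6's
`Summit.ABC.IUTFork.Repair.RHShallowWuc.HStarShallowWuc` (p457446). TAKES NO SIDE on [IUTchIII] Cor. 3.12 or on any author; nothing here asserts
abc proved or refuted; `HStarShallowWuc` is an R-H CANDIDATE HYPOTHESIS, never asserted; typed ≠ proved; refuted-as-typed ≠ refuted-in-print.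

THE FAMILY (landed, BY NAME). U1 = abc-iut-rp-d2's `Repair.CandInternal2Real.not_mem_jsq_smul_logShell_of_unramified` (p432650): at an absolutely
unramified odd place (`e = 1`, `p ≠ 2`) the real log-shell is `𝒪_K`, so `q ∉ q^{j²}·ℐ_K` for every non-unit `q ≠ 0` and every label `j ≥ 2` —
the content of RP-I06 / I06⋆ (`CandInternal11Gap.HQShellOrbitStar`) fails there identically. (Its region-level twin, abc-iut's
`Repair.EvalHonestCeiling.i06_false_of_honest`, is not needed below: H⋆_6 is a datum-side class, not a region inclusion.)

RESULTS (namespace `Summit.ABC.IUTFork.Repair.RHShallowWucUnramOdd`):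
* §1 `not_shallowWucRow_of_ramIdx_one` — INTEGER FORM: the row predicate `ShallowWucRow p 1 m L` is false for every `p`, `m` once `L = l⋆ ≥ 2`
  (`1 ≤ m ∧ L²·m ≤ 1` is impossible); `not_shallowWucRow_rat_p7` — the unram-odd row of record (R-W WINDOW-TABLE `S-RAT` = I06STAR-COLUMNS
  `concrete:Cor312LicenceSharpRat@p7.j2`: `p = 7`, `e_w = 1`, `l = 5`, `l⋆ = 2`), every `m_q`.
* §2 `hStar_false_of_unramified_bad` — DATUM LEVEL: `HStarShallowWuc D` is contradictory at any genuine datum `pilotDataOfK D K` with a bad place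
  `w` of `K` having `ramIdx K w = 1` (any residue characteristic; `l ≥ 5` is built into the datum, `PilotData.two_le_lstar`);
  `lstar_sq_le_ramIdx_of_hStar` — positively: H⋆_6 forces `(l⋆)² ≤ e_w` at every bad place (so `e_w ≥ 4`): the candidate EXCLUDES the unram-odd
  stratum by its own shallow clause, exactly as I06⋆ is excluded there by U1.
* §3 `unramOdd_family_bites_hStar` — THE FAMILY BITES BY NAME: for q-ideles REALISING `P_q` (the certificate's `htq0`/`htq` binders), abc-iut-rh-typ-6's
  `RHShallowWuc.realStar_of_hStar` gives the real I06⋆ cell `t_{q,w} ∈ t_{q,w}^{4}·ℐ_{K_w}` at label `j = 2` (which exists, `l⋆ ≥ 2`), and U1 refutes it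
  at any bad `w | p`, `p ≠ 2`, with `absRamificationIdx p K_w = 1` (`‖t_{q,w}‖ = p^{−P_q(w)} < 1` by abc-iut-w5-d236's `norm_qIdele_eq_rpow_of_realises`).
  So every datum the unramified-odd family removes from I06⋆ it removes from H⋆_6 too: as a replacement binder for `hSHw` the candidate is dead on
  that stratum in the same way I06⋆ is (tester-k2: does NOT survive; consistent with §5 of p457446: scope EMPTY on R-W's HEX family).

HONEST SCOPE. Elementary consequences of p457446 and p432650; nothing about the printed GLOBAL inequality; whether any collection of initial Θ-data has an
unramified bad place is not claimed here ([IUTchI] Def. 3.1 (b),(c): `K ⊇ F(E[l])`, so generically `l ∣ e_w` at bad places — the stratum is thin).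
[cite: Mochizuki2012, IUTchI Def. 3.1 (b),(c) pp. 61–62, Ex. 3.2 (iv) p. 71] [cite: MochizukiAbsTopIII2015, Def 5.4 (iii) p. 126]
[cite: DupuyHilado2025, §3.3, §3.4] [claim: Mochizuki2012, status: disputed] for every IUT sentence quoted. Axioms: standard.
-/

noncomputable section

open Set Metric Function NumberField IsDedekindDomain
open scoped Pointwise

namespace Summit.ABC.IUTFork.Repair.RHShallowWucUnramOdd

open Literature.AnabelianGeometry.AbsoluteAnabelian Literature.IUT.LogThetaLattice Literature.IUT.LogVolume
  Literature.IUT.HodgeTheaters Literature.NumberTheory.NumberFields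
open Summit.ABC.IUTFork.Thm311 Summit.ABC.IUTFork.Thm311.Real Summit.ABC.IUTFork.Cor312 Summit.ABC.IUTFork.Cor312.Setting
  Summit.ABC.IUTFork.Cor312Vol Summit.ABC.IUTFork.Cor312Prov Summit.ABC.IUTFork.Repair.CandInternal2RealLabels
  Summit.ABC.IUTFork.Repair.CandInternal2RealLabelsLicenceGenuineK Summit.ABC.IUTFork.Repair.RHShallowWuc

/-! ## §1. Integer form: the row predicate is false at `e_w = 1` for every `m_q` once `l⋆ ≥ 2` -/

/-- **Row 6 at an unramified place, integer currency**: `ShallowWucRow p 1 m L` (tame ∧ `1 ≤ m` ∧ `L²·m ≤ 1`) is FALSE for every residue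
characteristic `p` and every q-degree `m` once `L = l⋆ ≥ 2` (i.e. `l ≥ 5`): `L²·m ≥ 4 > 1`. [folklore] -/
theorem not_shallowWucRow_of_ramIdx_one (p m L : ℕ) (hL : 2 ≤ L) : ¬ ShallowWucRow p 1 m L := by
  rintro ⟨-, hm, hsh⟩
  have h4 : 4 ≤ L ^ 2 := by nlinarith
  have : 4 ≤ L ^ 2 * m := by nlinarith
  omega

/-- The unram-odd row of record — R-W WINDOW-TABLE v1 `S-RAT` (REFUTED-concrete, kernel) = I06STAR-COLUMNS v1 `concrete:Cor312LicenceSharpRat@p7.j2`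
(`F = ℚ`, `p = 7`, `e_w = 1`, `l = 5`, so `l⋆ = 2`): the row-6 predicate fails there for EVERY `m_q`. [folklore] -/
theorem not_shallowWucRow_rat_p7 (m : ℕ) : ¬ ShallowWucRow 7 1 m 2 := not_shallowWucRow_of_ramIdx_one 7 m 2 le_rfl

/-! ## §2. Datum level: H⋆_6 is false at every genuine datum with an unramified bad place -/

variable {F K Fbar : Type} [Field F] [NumberField F] [Field K] [NumberField K] [Algebra F K] [Field Fbar]
  [Algebra F Fbar] [Algebra K Fbar] {E : WeierstrassCurve F} [E.IsElliptic] {l : ℕ} {Pb : BadPlacePredicates K}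

/-- **H⋆_6 FAILS AT EVERY UNRAMIFIED BAD PLACE (datum level).** If the genuine `K`-level datum `pilotDataOfK D K` of a collection of initial Θ-data
`D` has a bad place `w` with `ramIdx K w = 1`, then `HStarShallowWuc D` is contradictory: by abc-iut-rh-typ-6's dictionary `hStar_iff_rows` the place's
row would satisfy `ShallowWucRow p_w 1 m_q l⋆` with `l⋆ ≥ 2` (`PilotData.two_le_lstar`), impossible by §1. Any residue characteristic (the tame clause
is not even used). [cite: Mochizuki2012, IUTchI Def. 3.1 (b),(c) pp. 61–62, Ex. 3.2 (iv) p. 71] [claim: Mochizuki2012, status: disputed] -/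
theorem hStar_false_of_unramified_bad (D : InitialThetaData F K Fbar E l Pb) (h : HStarShallowWuc D)
    (w : HeightOneSpectrum (𝓞 K)) (hS : w ∈ (pilotDataOfK D K).S) (he : ramIdx K w = 1) : False := by
  obtain ⟨m, -, hrow⟩ := (hStar_iff_rows D).1 h w hS
  rw [he] at hrow
  exact not_shallowWucRow_of_ramIdx_one _ _ _ (pilotDataOfK D K).two_le_lstar hrow

/-- **Positively: H⋆_6 forces `(l⋆)² ≤ e_w` at every bad place** (hence `e_w ≥ 4`; with the tame clause also `e_w ≤ p_w − 2`): the candidate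
EXCLUDES the unramified-odd stratum by its own shallow clause — the same stratum on which I06⋆ as typed is refuted by
`CandInternal2Real.not_mem_jsq_smul_logShell_of_unramified`. [cite: Mochizuki2012, IUTchI Ex. 3.2 (iv) p. 71] [claim: Mochizuki2012, status: disputed] -/
theorem lstar_sq_le_ramIdx_of_hStar (D : InitialThetaData F K Fbar E l Pb) (h : HStarShallowWuc D)
    (w : HeightOneSpectrum (𝓞 K)) (hS : w ∈ (pilotDataOfK D K).S) : (pilotDataOfK D K).lstar ^ 2 ≤ ramIdx K w := by
  obtain ⟨m, -, -, hm, hsh⟩ := (hStar_iff_rows D).1 h w hS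
  calc (pilotDataOfK D K).lstar ^ 2 = (pilotDataOfK D K).lstar ^ 2 * 1 := by ring
    _ ≤ (pilotDataOfK D K).lstar ^ 2 * m := Nat.mul_le_mul_left _ hm
    _ ≤ ramIdx K w := hsh

/-! ## §3. The family bites BY NAME: `realStar_of_hStar` at label `j = 2` + U1 -/

variable (D : InitialThetaData F K Fbar E l Pb)
  (tq : ∀ (pp : Nat.Primes) (x : (thetaIndex (pilotDataOfK D K)).Fibre (.inr pp)),
    haveI : Fact (pp : ℕ).Prime := ⟨pp.2⟩; kOf (pilotDataOfK D K) pp.1 x)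
  (htq0 : ∀ pp x, tq pp x ≠ 0)
  (htq : ∀ (pp : Nat.Primes) (x : (thetaIndex (pilotDataOfK D K)).Fibre (.inr pp)),
    haveI : Fact (pp : ℕ).Prime := ⟨pp.2⟩
    Real.log ‖tq pp x‖ = -((pilotDataOfK D K).qPilot (placeOf (pilotDataOfK D K) pp.1 x)) *
      logNorm K (placeOf (pilotDataOfK D K) pp.1 x) / localDegree K (placeOf (pilotDataOfK D K) pp.1 x))

include htq0 htq in
/-- **THE UNRAMIFIED-ODD FAMILY BITES H⋆_6, BY NAME.** For q-ideles `t_q` REALISING `P_q` (the window certificate's own `htq0`/`htq` binders):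
if `HStarShallowWuc D`, then at any bad place `w | p` of the genuine datum with `p ≠ 2` whose completion `K_w` is absolutely unramified
(`absRamificationIdx p K_w = 1`) we get `False` — abc-iut-rh-typ-6's `RHShallowWuc.realStar_of_hStar` puts `t_{q,w}` in `t_{q,w}^{2²}·ℐ_{K_w}` (label
`j = 2`, available since `l⋆ ≥ 2`), while abc-iut-rp-d2's `CandInternal2Real.not_mem_jsq_smul_logShell_of_unramified` forbids it
(`‖t_{q,w}‖ = p^{−P_q(w)} < 1`, abc-iut-w5-d236 `norm_qIdele_eq_rpow_of_realises`, `P_q ≥ 1`). So the family that killed I06⋆ as typed on this stratum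
kills H⋆_6 there too. [cite: MochizukiAbsTopIII2015, Def 5.4 (iii) p. 126] [cite: DupuyHilado2025, §3.4] [claim: Mochizuki2012, status: disputed] -/
theorem unramOdd_family_bites_hStar (h : HStarShallowWuc D) (pp : Nat.Primes) (hp2 : (pp : ℕ) ≠ 2)
    (w : (thetaIndex (pilotDataOfK D K)).Fibre (.inr pp))
    (hw : haveI : Fact (pp : ℕ).Prime := ⟨pp.2⟩; placeOf (pilotDataOfK D K) pp.1 w ∈ (pilotDataOfK D K).S)
    (he : haveI : Fact (pp : ℕ).Prime := ⟨pp.2⟩; absRamificationIdx (pp : ℕ) (kOf (pilotDataOfK D K) pp.1 w) = 1) : False := by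
  haveI hF : Fact (pp : ℕ).Prime := ⟨pp.2⟩
  have h2 : 1 < (pilotDataOfK D K).lstar := by have := (pilotDataOfK D K).two_le_lstar; omega
  have hstar := realStar_of_hStar D tq htq0 htq h pp ⟨1, h2⟩ w hw
  have hram : ramIdx K (placeOf (pilotDataOfK D K) pp.1 w) = 1 := by
    rw [ramIdx_eq K (placeOf (pilotDataOfK D K) pp.1 w),
      ← absRamificationIdx_rescaledCompletion K (pp : ℕ) (placeOf (pilotDataOfK D K) pp.1 w)
        (natCast_mem_placeOf (pilotDataOfK D K) pp.1 w), he]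
  have hP : (1 : ℝ) ≤ (pilotDataOfK D K).qPilot (placeOf (pilotDataOfK D K) pp.1 w) := (h.2 _ hw).1
  have hlt : ‖tq pp w‖ < 1 := by
    rw [norm_qIdele_eq_rpow_of_realises (pilotDataOfK D K) tq htq0 htq pp w, hram]
    apply Real.rpow_lt_one_of_one_lt_of_neg
    · exact_mod_cast pp.2.one_lt
    · push_cast
      have : (0 : ℝ) < (pilotDataOfK D K).qPilot (placeOf (pilotDataOfK D K) pp.1 w) / 1 := by
        rw [div_one]; linarith
      linarith [this]
  exact CandInternal2Real.not_mem_jsq_smul_logShell_of_unramified (pp : ℕ) (kOf (pilotDataOfK D K) pp.1 w) hp2 he (htq0 pp w) hlt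
    (j := 2) le_rfl (by simpa using hstar)

end Summit.ABC.IUTFork.Repair.RHShallowWucUnramOdd

end
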